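import Summits.BirchSwinnertonDyer.BirchSwinnertonDyer.Theorems.TeichmullerTwistDescentKOfWeightExclusion
import Summits.BirchSwinnertonDyer.BirchSwinnertonDyer.Theorems.TeichmullerTwistDescentOrdinaryLowValuationOfSaturation
import Summits.BirchSwinnertonDyer.BirchSwinnertonDyer.Theorems.TeichmullerTwistDescentNeronLatticeTwistPStarOfLowValuation
import HarnessLib

/-!
# Route `TeichmullerTwistDescent`: GE11 `OrdinaryLowValuationOptimalManinUnitGeEleven` (stmt-BirchSwinnertonDyer-23885)
# from its REMAINING NAMED INPUTS — modularity, Edixhoven's Kodaira-type theorem, the rational tame-type functional (I1″)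
# and the weight exclusion (W″)

Cell `pub/bsd-wall` (D-0145 line route-BirchSwinnertonDyer-TeichmullerTwistDescent, OPEN rev 7), seat `bsd-line-ttd-p1`
(prover 1/2, g25).  THEOREMS ONLY; `--supports stmt-BirchSwinnertonDyer-25368`.  A CLOSURE CERTIFICATE, not a closing file:
BSD is not proved; GE11 / K are NOT proved (conditional); nothing here closes an item.

The LINE 11 glue `OrdinaryLowValuationOfSaturation` (K → NTL → Facts → GE11) and NTL are PROVED in the tree
(`ordinaryLowValuationOfSaturation_proof`, `neronLatticeTwistPStarOfLowValuation_proof`); K is proved from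
`exists_isNewformOf`, `RationalTameTypeCarrierFunctional` (I1″) and `NoEtaleWeightQuotient` (W″)
(`KOfWeightExclusion.twistedPeriodLatticeSaturation_of_rational_of_noEtaleWeightQuotient`, g25).  Hence the `p ≥ 11`
potentially ordinary II/III/IV optimal Manin statement GE11 — Edixhoven's 1991 §4 «case 2», open in print — holds GRANTED
exactly: modularity (`exists_isNewformOf`, cite), Edixhoven 1991 Thm. 3 outside II/III/IV
(`edixhoven_not_dvd_maninConstant_of_kodairaSymbol_ne`, cite), and the two route-posited inputs (I1″) [automorphic type at
`p` of the full-level homology] and (W″) [Serre-weight exclusion].  [cite: EdixhovenManin1991, §4 and Thm. 3]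
[cite: Stevens1989, Lemma (5.2) and (5.4)]
-/

set_option autoImplicit false
-- single-conjunct summit: `Summit.BirchSwinnertonDyer.BirchSwinnertonDyer.…` repeats the name by design
set_option linter.dupNamespace false

noncomputable section

namespace Summit.BirchSwinnertonDyer.BirchSwinnertonDyer.Theorems.TeichmullerTwistDescent

open Literature.NumberTheory.EllipticCurves.ModularForms
open Summit.BirchSwinnertonDyer.BirchSwinnertonDyer.Theses.TeichmullerTwistDescent

namespace KOfWeightExclusion

/-- **GE11 from its remaining named inputs.**  `OrdinaryLowValuationOptimalManinUnitGeEleven` (the route decl, verbatim)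
follows from modularity, Edixhoven's Kodaira-type theorem, the rational tame-type carrier functional (I1″) and the weight
exclusion (W″), through K (`twistedPeriodLatticeSaturation_of_rational_of_noEtaleWeightQuotient`), the proved Néron twist
lemma and the proved LINE 11 glue.  BSD is not proved by this; GE11 is proved CONDITIONALLY on the four named hypotheses.
[cite: EdixhovenManin1991, §4 and Thm. 3] [cite: Stevens1989, Lemma (5.2)] -/
theorem ordinaryLowValuationOptimalManinUnitGeEleven_of_inputs (hnf : exists_isNewformOf)
    (hEdix : edixhoven_not_dvd_maninConstant_of_kodairaSymbol_ne)
    (hrat : RationalTameTypeCarrierFunctional) (hwt : NoEtaleWeightQuotient) :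
    OrdinaryLowValuationOptimalManinUnitGeEleven :=
  ordinaryLowValuationOfSaturation_proof
    (twistedPeriodLatticeSaturation_of_rational_of_noEtaleWeightQuotient hnf hrat hwt)
    neronLatticeTwistPStarOfLowValuation_proof ⟨hEdix, hnf⟩

end KOfWeightExclusion

end Summit.BirchSwinnertonDyer.BirchSwinnertonDyer.Theorems.TeichmullerTwistDescent
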